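import Mathlib.NumberTheory.NumberField.ClassNumber
import Literature.NumberTheory.QuadraticFields.RealQuadraticClassNumberOneSmall
import Literature.NumberTheory.QuadraticFields.IdealsOfPrimePowerNormCases
import Literature.NumberTheory.QuadraticFields.FormIdeals
import HarnessLib

/-!
# The real quadratic field of discriminant `1365 = 3·5·7·13` has class number `4`

Topic `NumberTheory/QuadraticFields`, namespace `Literature.NumberTheory.QuadraticFields.Quadratic`, continuing
`RealQuadraticClassNumberOneSmall.lean` / `RealQuadraticClassNumberOneInert.lean` (class number ONE below the
Minkowski bound). Everything here is PROVED (theorems only; no definition, no named fact, no instance); the field is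
an abstract number field `K` with `[K : ℚ] = 2` and `d_K = 1365`, and — new in this file — the integral basis is
NORMALISED: for `d_K ≡ 1 (mod 4)` there is a `ℤ`-basis `(1, ω)` of `𝓞 K` with `ω² = ω + (d_K − 1)/4`
(`exists_basis_sq_eq_add_of_emod_four_eq_one`), here `ω² = ω + 341`, norm form `N(x + yω) = x² + xy − 341y²`.

The computation is the textbook one (Marcus, *Number Fields*, Ch. 5, Cor. 2 of Thm. 37 and the worked examples after
it; Cohen, GTM 138, §5.7 / Appendix B.2 lists `h(1365) = 4`):

* Minkowski: `M_K = √1365/2 < 19`, so `Cl(K)` is generated by the classes of the prime ideals of norm `≤ 18`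
  (Mathlib `NumberField.exists_ideal_in_class_of_norm_le`, then peeling maximal ideals off an ideal of norm `≤ 18`);
* the primes: `2` and `17` are INERT (`1365 ≡ 5 (mod 8)`, `(1365/17) = −1`: a maximal ideal containing `p` is `(p)`);
  `3, 5, 7, 13` are RAMIFIED, `𝔭_p = (p, ω − k)` with `k = 2, 3, 4, 7` and `𝔭_p² = (p)`; `11` SPLITS,
  `𝔭₁₁ = (11, ω)`, `𝔭₁₁' = (11, ω − 1)`, `𝔭₁₁ 𝔭₁₁' = (11)` (the tree's `eq_or_eq_of_isPrime_of_natCast_mem`,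
  `span_pair_mul_span_pair_conj`, `span_pair_conj_eq_of_dvd`);
* RELATIONS from principal ideals of small norm: `N(17 + ω) = −35`, `N(19 + ω) = 39`, `N(22 + ω) = 165` give
  `(17 + ω) = 𝔭₅𝔭₇`, `(19 + ω) = 𝔭₃𝔭₁₃`, `(22 + ω) = 𝔭₃𝔭₅𝔭₁₁` (the element lies in each factor, coprime factors
  multiply to their intersection, equal norms force equality) — so every class is one of `1, [𝔭₃], [𝔭₅], [𝔭₃𝔭₅]`;
* NON-PRINCIPALITY: `x² + xy − 341y² = ±3, ±5, ±15` are insoluble (`4N = (2x+y)² − 1365y²`; `±12` is not a square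
  mod `5`; `+20` none mod `3`, `−20` none mod `13`; `+60` none mod `13`, `−60` none mod `7` — checked by `decide` in
  `ZMod`), so `𝔭₃`, `𝔭₅`, `𝔭₃𝔭₅` are not principal and the four classes are distinct.

Hence **`classNumber_eq_four_of_discr_eq_1365 : [K:ℚ] = 2 → d_K = 1365 → h_K = 4`**, and with the kernel unit
`QuadIrr.fundUnit_1365 = (37 + √1365)/2` (`RealQuadraticFundamentalUnitValues.lean`)
`classNumber_mul_regulator_of_discr_eq_1365 : h_K R_K = 4 log((37 + √1365)/2)`. First consumer: the landau-siegel
rescue bed (`Zhang2022/RepairBedClassNumberFormulaReal.lean`: `L(1, χ₁₃₆₅) = 8 log ε/√1365`).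

## References

* [Marcus1977] D. A. Marcus, *Number Fields*, Ch. 5, Thm. 35–37, Cor. 2 and the examples after it.
* [Cohen1993] H. Cohen, *A Course in Computational Algebraic Number Theory*, GTM 138 (1993), §5.7, Appendix B.2.
* [Cox2013] D. A. Cox, *Primes of the form x² + ny²*, 2nd ed. (2013), §5.B Prop. 5.16, §7.B Thm. 7.7.
-/

noncomputable section

open Module NumberField NumberField.InfinitePlace Ideal
open scoped nonZeroDivisors

namespace Literature.NumberTheory.QuadraticFields.Quadratic

variable {K : Type*} [Field K] [NumberField K]

/-! ### Generic helpers -/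

/-- Ideals `J ≤ I` of `𝓞 K` with the same non-zero norm are equal (`J = I·L`, `N(L) = 1`, `L = ⊤`).
[cite: Marcus1977, Ch. 5, discussion after Thm. 37] -/
theorem eq_of_le_of_absNorm_eq {I J : Ideal (𝓞 K)} (hle : J ≤ I) (hN : absNorm J = absNorm I)
    (h0 : absNorm J ≠ 0) : J = I := by
  obtain ⟨L, hL⟩ := Ideal.dvd_iff_le.mpr hle
  have hI0 : absNorm I ≠ 0 := hN ▸ h0
  have h1 : absNorm L = 1 := by
    have h := congrArg absNorm hL
    rw [map_mul, hN] at h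
    exact Nat.eq_of_mul_eq_mul_left (Nat.pos_of_ne_zero hI0) (by rw [mul_one]; exact h.symm)
  rw [absNorm_eq_one_iff] at h1
  rw [hL, h1, Ideal.mul_top]

/-- **Two coprime ideals whose product has the norm of a common element `α` multiply to `(α)`**:
`I·J = I ⊓ J ⊇ (α)` and equal norms. [cite: Marcus1977, Ch. 5, discussion after Thm. 37] -/
theorem mul_eq_span_singleton_of_coprime {I J : Ideal (𝓞 K)} (hcop : I ⊔ J = ⊤) {α : 𝓞 K} (hαI : α ∈ I)
    (hαJ : α ∈ J) (hN : absNorm (span {α}) = absNorm I * absNorm J) (h0 : absNorm (span {α}) ≠ 0) :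
    I * J = span {α} := by
  have hle : span {α} ≤ I * J := by
    rw [Ideal.mul_eq_inf_of_coprime hcop, span_singleton_le_iff_mem]
    exact ⟨hαI, hαJ⟩
  exact (eq_of_le_of_absNorm_eq hle (by rw [map_mul, hN]) h0).symm

/-- **A normalised integral basis for `d_K ≡ 1 (mod 4)`**: there is a `ℤ`-basis `(1, ω)` of `𝓞 K` with
`ω² = (d_K − 1)/4 + ω` (shift the `ω` of any basis `(1, ω)`, `ω² = m + tω`, `t = 2j + 1`, by `j`).
[cite: Marcus1977, Ch. 2 Thm. 1] -/
theorem exists_basis_sq_eq_add_of_emod_four_eq_one (h2 : finrank ℚ K = 2) (h1 : NumberField.discr K % 4 = 1) :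
    ∃ b : Basis (Fin 2) ℤ (𝓞 K), b 0 = 1 ∧
      b 1 * b 1 = (((NumberField.discr K - 1) / 4 : ℤ) : 𝓞 K) + ((1 : ℤ) : 𝓞 K) * b 1 := by
  obtain ⟨e, he⟩ := exists_basis_zero_eq_one (K := K) h2
  have hω := basis_one_mul_self_eq e he
  have hdisc := discr_eq_sq_add_four_mul e he
  set t : ℤ := e.repr (e 1 * e 1) 1
  set m : ℤ := e.repr (e 1 * e 1) 0
  -- `t` is odd
  obtain ⟨j, hj⟩ : ∃ j, t = 2 * j + 1 := by
    rcases Int.emod_two_eq_zero_or_one t with ht | ht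
    · exfalso
      obtain ⟨s, hs⟩ : ∃ s, t = 2 * s := ⟨t / 2, by omega⟩
      have : NumberField.discr K = 4 * (s ^ 2 + m) := by rw [hdisc, hs]; ring
      omega
    · exact ⟨t / 2, by omega⟩
  have hq : (NumberField.discr K - 1) / 4 = m + j ^ 2 + j := by
    have : NumberField.discr K - 1 = 4 * (m + j ^ 2 + j) := by rw [hdisc, hj]; ring
    omega
  -- the new basis `(1, ω − j)`
  set w : Fin 2 → 𝓞 K := ![e 0, e 1 - j • e 0] with hw
  have hdet : e.det w = 1 := by
    rw [e.det_apply, Matrix.det_fin_two]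
    simp only [e.toMatrix_apply, hw, Matrix.cons_val_zero, Matrix.cons_val_one, map_sub, map_zsmul,
      e.repr_self, Finsupp.coe_sub, Finsupp.coe_smul, Pi.sub_apply, Pi.smul_apply, Finsupp.single_apply,
      smul_eq_mul]
    simp
  obtain ⟨hli, hsp⟩ := (Module.Basis.is_basis_iff_det e).mpr (hdet ▸ isUnit_one)
  refine ⟨Basis.mk hli hsp.ge, by simp [hw, he], ?_⟩
  have hb1 : (Basis.mk hli hsp.ge : Basis (Fin 2) ℤ (𝓞 K)) 1 = e 1 - (j : 𝓞 K) := by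
    simp [hw, he, zsmul_eq_mul]
  rw [hb1, hq]
  rw [hj] at hω
  push_cast at hω ⊢
  linear_combination hω

/-! ### Ramified, inert, principal: consequences of the tree's description of the primes above `p` -/

section Primes

variable (b : Basis (Fin 2) ℤ (𝓞 K)) (hb : b 0 = 1) {t m : ℤ}
  (hω : b 1 * b 1 = (m : 𝓞 K) + (t : 𝓞 K) * b 1)

include hb hω in
/-- **Ramified `p`: every prime `Q ∋ p` is `𝔭 = (p, ω − k)`** when `pC = k² − tk − m`, `gcd(p, 2k − t, C) = 1` and
`p ∣ 2k − t` (then `𝔭' = 𝔭`). [cite: Cox2013, §5.B Prop. 5.16] -/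
theorem eq_span_pair_of_ramified {p : ℕ} (hp : p.Prime) {k C : ℤ} (hn : (p : ℤ) * C = k ^ 2 - t * k - m)
    (hprim : ∀ d : ℤ, d ∣ (p : ℤ) → d ∣ 2 * k - t → d ∣ C → IsUnit d) (hram : (p : ℤ) ∣ 2 * k - t)
    {Q : Ideal (𝓞 K)} (hQ : Q.IsPrime) (hpQ : (p : 𝓞 K) ∈ Q) :
    Q = span {((p : ℤ) : 𝓞 K), b 1 - k} := by
  rcases eq_or_eq_of_isPrime_of_natCast_mem b hb hω hp hn hprim hQ hpQ with h | h
  · exact h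
  · rw [h, span_pair_conj_eq_of_dvd b hram]

include hω in
/-- **Ramified `p`: `𝔭² = (p)`.** [cite: Cox2013, §5.B Prop. 5.16] -/
theorem span_pair_mul_self_of_ramified {p : ℕ} {k C : ℤ} (hn : (p : ℤ) * C = k ^ 2 - t * k - m)
    (hprim : ∀ d : ℤ, d ∣ (p : ℤ) → d ∣ 2 * k - t → d ∣ C → IsUnit d) (hram : (p : ℤ) ∣ 2 * k - t) :
    span {((p : ℤ) : 𝓞 K), b 1 - k} * span {((p : ℤ) : 𝓞 K), b 1 - k} = span {((p : ℤ) : 𝓞 K)} := by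
  have h := span_pair_mul_span_pair_conj b hω hn hprim
  rwa [span_pair_conj_eq_of_dvd b hram] at h

include hb hω in
/-- **Inert `p`: every maximal `Q ∋ p` is `(p)`** when `X² − tX − m` has no root mod `p` (no ideal of norm `p`
exists, so `N(Q) = p² = N((p))` and `(p) ≤ Q`). [cite: Marcus1977, Ch. 3 Thm. 25] -/
theorem eq_span_natCast_of_inert {p : ℕ} (hp : p.Prime) (hno : ∀ k C : ℤ, (p : ℤ) * C ≠ k ^ 2 - t * k - m)
    {Q : Ideal (𝓞 K)} (hQ : Q.IsMaximal) (hpQ : (p : 𝓞 K) ∈ Q) : Q = span {(p : 𝓞 K)} := by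
  have hle : span {(p : 𝓞 K)} ≤ Q := (span_singleton_le_iff_mem _).mpr hpQ
  have hNp : absNorm (span {(p : 𝓞 K)}) = p ^ 2 := by
    have h := absNorm_span_singleton_intCast b (p : ℤ)
    rwa [Int.cast_natCast, Int.natAbs_natCast] at h
  have hdvd : absNorm Q ∣ p ^ 2 := hNp ▸ absNorm_dvd_absNorm_of_le hle
  obtain ⟨i, hi, hieq⟩ := (Nat.dvd_prime_pow hp).mp hdvd
  interval_cases i
  · exact absurd (absNorm_eq_one_iff.mp (by rw [hieq, pow_zero])) hQ.ne_top
  · exfalso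
    rw [pow_one] at hieq
    obtain ⟨k, C, hkC, -⟩ := exists_eq_span_pair_of_absNorm_eq_prime b hb hω hp hieq
    exact hno k C hkC
  · exact (eq_of_le_of_absNorm_eq hle (by rw [hieq, hNp]) (by rw [hNp]; exact pow_ne_zero 2 hp.ne_zero)).symm

include hb hω in
/-- **An ideal whose norm is not a value of `|x² + txy − my²|` is not principal** (a generator `x + yω` would have
that norm). [cite: Cox2013, §7.B Thm. 7.7] -/
theorem not_isPrincipal_of_normForm_ne {I : Ideal (𝓞 K)} {n : ℕ} (hI : absNorm I = n)
    (hno : ∀ x y : ℤ, (x ^ 2 + t * x * y - m * y ^ 2).natAbs ≠ n) : ¬ Submodule.IsPrincipal I := by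
  intro hP
  obtain ⟨α, hα⟩ := (Submodule.isPrincipal_iff I).mp hP
  have hαeq := eq_repr_add_repr_mul_of_basis b hb α
  apply hno (b.repr α 0) (b.repr α 1)
  rw [← absNorm_span_intCast_add_mul b hb hω, ← hαeq, ← hI, hα, submodule_span_eq]

end Primes

/-! ### `d_K = 1365`: the primes of norm `≤ 18` and their relations (basis `ω² = 341 + ω`) -/

section D1365

variable (b : Basis (Fin 2) ℤ (𝓞 K)) (hb : b 0 = 1)
  (hω : b 1 * b 1 = ((341 : ℤ) : 𝓞 K) + ((1 : ℤ) : 𝓞 K) * b 1)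

/-- `gcd(a, c) = 1 ⇒` a common divisor is a unit. [folklore] -/
private theorem isUnit_of_dvd_of_dvd {d a c : ℤ} (ha : d ∣ a) (hc : d ∣ c) (h : Int.gcd a c = 1) : IsUnit d :=
  isUnit_of_dvd_one (by have := Int.dvd_coe_gcd ha hc; rwa [h] at this)

include hb hω in
/-- A maximal ideal of `𝓞 K` (`d_K = 1365`) containing a prime `p ≤ 18` is one of `(2)`, `(17)`, `𝔭₃ = (3, ω − 2)`,
`𝔭₅ = (5, ω − 3)`, `𝔭₇ = (7, ω − 4)`, `𝔭₁₃ = (13, ω − 7)`, `𝔭₁₁ = (11, ω)`, `𝔭₁₁' = (11, ω − 1)`.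
[cite: Marcus1977, Ch. 5, examples after Cor. 2 of Thm. 37] -/
theorem maximal_mem_cases_1365 {Q : Ideal (𝓞 K)} (hQ : Q.IsMaximal) {p : ℕ} (hp : p.Prime) (hp18 : p ≤ 18)
    (hpQ : (p : 𝓞 K) ∈ Q) :
    Q = span {(2 : 𝓞 K)} ∨ Q = span {(17 : 𝓞 K)} ∨
      Q = span {(((3 : ℕ) : ℤ) : 𝓞 K), b 1 - (2 : ℤ)} ∨ Q = span {(((5 : ℕ) : ℤ) : 𝓞 K), b 1 - (3 : ℤ)} ∨
      Q = span {(((7 : ℕ) : ℤ) : 𝓞 K), b 1 - (4 : ℤ)} ∨ Q = span {(((13 : ℕ) : ℤ) : 𝓞 K), b 1 - (7 : ℤ)} ∨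
      Q = span {(((11 : ℕ) : ℤ) : 𝓞 K), b 1 - (0 : ℤ)} ∨ Q = span {(((11 : ℕ) : ℤ) : 𝓞 K), b 1 - (1 : ℤ)} := by
  have hQp := hQ.isPrime
  interval_cases p
  all_goals first
    | exact absurd hp (by decide)
    | skip
  · -- p = 2, inert
    refine Or.inl (by
      have h := eq_span_natCast_of_inert b hb hω Nat.prime_two (fun k C hkC => ?_) hQ hpQ
      · simpa using h
      · obtain ⟨e, he⟩ := Int.even_mul_pred_self k
        have hk : k ^ 2 - 1 * k - 341 = k * (k - 1) - 341 := by ring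
        rw [hk, he] at hkC
        push_cast at hkC
        omega)
  · -- p = 3, ramified
    exact Or.inr (Or.inr (Or.inl (eq_span_pair_of_ramified b hb hω hp (k := 2) (C := -113) (by norm_num)
      (fun d h1 _ h3 => isUnit_of_dvd_of_dvd h1 h3 (by decide)) (by norm_num) hQp (by exact_mod_cast hpQ))))
  · -- p = 5
    exact Or.inr (Or.inr (Or.inr (Or.inl (eq_span_pair_of_ramified b hb hω hp (k := 3) (C := -67) (by norm_num)
      (fun d h1 _ h3 => isUnit_of_dvd_of_dvd h1 h3 (by decide)) (by norm_num) hQp (by exact_mod_cast hpQ)))))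
  · -- p = 7
    exact Or.inr (Or.inr (Or.inr (Or.inr (Or.inl (eq_span_pair_of_ramified b hb hω hp (k := 4) (C := -47)
      (by norm_num) (fun d h1 _ h3 => isUnit_of_dvd_of_dvd h1 h3 (by decide)) (by norm_num) hQp
      (by exact_mod_cast hpQ))))))
  · -- p = 11, split
    rcases eq_or_eq_of_isPrime_of_natCast_mem b hb hω hp (k := 0) (C := -31) (by norm_num)
      (fun d _ h2 _ => isUnit_of_dvd_one (by simpa using h2)) hQp (by exact_mod_cast hpQ) with h | h
    · exact Or.inr (Or.inr (Or.inr (Or.inr (Or.inr (Or.inr (Or.inl h))))))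
    · refine Or.inr (Or.inr (Or.inr (Or.inr (Or.inr (Or.inr (Or.inr ?_))))))
      rw [h]
      norm_num
  · -- p = 13
    exact Or.inr (Or.inr (Or.inr (Or.inr (Or.inr (Or.inl (eq_span_pair_of_ramified b hb hω hp (k := 7)
      (C := -23) (by norm_num) (fun d h1 _ h3 => isUnit_of_dvd_of_dvd h1 h3 (by decide)) (by norm_num) hQp
      (by exact_mod_cast hpQ)))))))
  · -- p = 17, inert
    refine Or.inr (Or.inl (by
      have h := eq_span_natCast_of_inert b hb hω hp (fun k C hkC => ?_) hQ hpQ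
      · simpa using h
      · have h17 := congrArg (Int.cast : ℤ → ZMod 17) hkC
        push_cast at h17
        revert h17
        generalize (k : ZMod 17) = a
        generalize (C : ZMod 17) = c
        revert a c
        decide))

include hω in
/-- `𝔭₃² = (3)`. [cite: Cox2013, §5.B Prop. 5.16] -/
theorem p3_sq_1365 : span {(((3 : ℕ) : ℤ) : 𝓞 K), b 1 - (2 : ℤ)} * span {(((3 : ℕ) : ℤ) : 𝓞 K), b 1 - (2 : ℤ)} =
    span {(((3 : ℕ) : ℤ) : 𝓞 K)} :=
  span_pair_mul_self_of_ramified b hω (C := -113) (by norm_num)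
    (fun _ h1 _ h3 => isUnit_of_dvd_of_dvd h1 h3 (by decide)) (by norm_num)

include hω in
/-- `𝔭₅² = (5)`. [cite: Cox2013, §5.B Prop. 5.16] -/
theorem p5_sq_1365 : span {(((5 : ℕ) : ℤ) : 𝓞 K), b 1 - (3 : ℤ)} * span {(((5 : ℕ) : ℤ) : 𝓞 K), b 1 - (3 : ℤ)} =
    span {(((5 : ℕ) : ℤ) : 𝓞 K)} :=
  span_pair_mul_self_of_ramified b hω (C := -67) (by norm_num)
    (fun _ h1 _ h3 => isUnit_of_dvd_of_dvd h1 h3 (by decide)) (by norm_num)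

include hω in
/-- `𝔭₁₁ 𝔭₁₁' = (11)`. [cite: Cox2013, §5.B Prop. 5.16] -/
theorem p11_mul_conj_1365 :
    span {(((11 : ℕ) : ℤ) : 𝓞 K), b 1 - (0 : ℤ)} * span {(((11 : ℕ) : ℤ) : 𝓞 K), b 1 - (1 : ℤ)} =
      span {(((11 : ℕ) : ℤ) : 𝓞 K)} := by
  have h := span_pair_mul_span_pair_conj b hω (A := ((11 : ℕ) : ℤ)) (k := 0) (C := -31) (by norm_num)
    (fun d _ h2 _ => isUnit_of_dvd_one (by simpa using h2))
  norm_num at h ⊢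
  exact h

include hb hω in
/-- Norms: `N𝔭₃ = 3`, `N𝔭₅ = 5`, `N𝔭₇ = 7`, `N𝔭₁₃ = 13`, `N𝔭₁₁ = 11`. [cite: Cox2013, §7.B Thm. 7.7] -/
theorem absNorm_primes_1365 :
    absNorm (span {(((3 : ℕ) : ℤ) : 𝓞 K), b 1 - (2 : ℤ)}) = 3 ∧ absNorm (span {(((5 : ℕ) : ℤ) : 𝓞 K), b 1 - (3 : ℤ)}) = 5 ∧
      absNorm (span {(((7 : ℕ) : ℤ) : 𝓞 K), b 1 - (4 : ℤ)}) = 7 ∧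
      absNorm (span {(((13 : ℕ) : ℤ) : 𝓞 K), b 1 - (7 : ℤ)}) = 13 ∧
      absNorm (span {(((11 : ℕ) : ℤ) : 𝓞 K), b 1 - (0 : ℤ)}) = 11 :=
  ⟨absNorm_span_pair_prime b hb hω (C := -113) (by norm_num),
    absNorm_span_pair_prime b hb hω (C := -67) (by norm_num),
    absNorm_span_pair_prime b hb hω (C := -47) (by norm_num),
    absNorm_span_pair_prime b hb hω (C := -23) (by norm_num),
    absNorm_span_pair_prime b hb hω (C := -31) (by norm_num)⟩

include hb hω in
/-- **`(17 + ω) = 𝔭₅ 𝔭₇`** (`N(17 + ω) = 17² + 17 − 341 = −35`). [cite: Marcus1977, Ch. 5, examples after Cor. 2 of Thm. 37] -/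
theorem p5_mul_p7_1365 :
    span {(((5 : ℕ) : ℤ) : 𝓞 K), b 1 - (3 : ℤ)} * span {(((7 : ℕ) : ℤ) : 𝓞 K), b 1 - (4 : ℤ)} =
      span {((17 : ℤ) : 𝓞 K) + ((1 : ℤ) : 𝓞 K) * b 1} := by
  obtain ⟨-, h5, h7, -, -⟩ := absNorm_primes_1365 b hb hω
  have hN : absNorm (span {((17 : ℤ) : 𝓞 K) + ((1 : ℤ) : 𝓞 K) * b 1}) = 35 := by
    rw [absNorm_span_intCast_add_mul b hb hω]; norm_num
  refine mul_eq_span_singleton_of_coprime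
    ((isMaximal_of_absNorm_eq_prime (by norm_num) h5).coprime_of_ne (isMaximal_of_absNorm_eq_prime (by norm_num) h7)
      fun h => by have := congrArg absNorm h; rw [h5, h7] at this; norm_num at this)
    (Ideal.mem_span_pair.mpr ⟨4, 1, by push_cast; ring⟩) (Ideal.mem_span_pair.mpr ⟨3, 1, by push_cast; ring⟩)
    (by rw [hN, h5, h7]) (by rw [hN]; norm_num)

include hb hω in
/-- **`(19 + ω) = 𝔭₃ 𝔭₁₃`** (`N(19 + ω) = 39`). [cite: Marcus1977, Ch. 5, examples after Cor. 2 of Thm. 37] -/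
theorem p3_mul_p13_1365 :
    span {(((3 : ℕ) : ℤ) : 𝓞 K), b 1 - (2 : ℤ)} * span {(((13 : ℕ) : ℤ) : 𝓞 K), b 1 - (7 : ℤ)} =
      span {((19 : ℤ) : 𝓞 K) + ((1 : ℤ) : 𝓞 K) * b 1} := by
  obtain ⟨h3, -, -, h13, -⟩ := absNorm_primes_1365 b hb hω
  have hN : absNorm (span {((19 : ℤ) : 𝓞 K) + ((1 : ℤ) : 𝓞 K) * b 1}) = 39 := by
    rw [absNorm_span_intCast_add_mul b hb hω]; norm_num
  refine mul_eq_span_singleton_of_coprime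
    ((isMaximal_of_absNorm_eq_prime (by norm_num) h3).coprime_of_ne (isMaximal_of_absNorm_eq_prime (by norm_num) h13)
      fun h => by have := congrArg absNorm h; rw [h3, h13] at this; norm_num at this)
    (Ideal.mem_span_pair.mpr ⟨7, 1, by push_cast; ring⟩) (Ideal.mem_span_pair.mpr ⟨2, 1, by push_cast; ring⟩)
    (by rw [hN, h3, h13]) (by rw [hN]; norm_num)

include hb hω in
/-- **`(22 + ω) = 𝔭₃ 𝔭₅ 𝔭₁₁`** (`N(22 + ω) = 165`). [cite: Marcus1977, Ch. 5, examples after Cor. 2 of Thm. 37] -/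
theorem p3_mul_p5_mul_p11_1365 :
    span {(((3 : ℕ) : ℤ) : 𝓞 K), b 1 - (2 : ℤ)} * span {(((5 : ℕ) : ℤ) : 𝓞 K), b 1 - (3 : ℤ)} *
        span {(((11 : ℕ) : ℤ) : 𝓞 K), b 1 - (0 : ℤ)} =
      span {((22 : ℤ) : 𝓞 K) + ((1 : ℤ) : 𝓞 K) * b 1} := by
  obtain ⟨h3, h5, -, -, h11⟩ := absNorm_primes_1365 b hb hω
  have hm3 := isMaximal_of_absNorm_eq_prime (by norm_num) h3
  have hm5 := isMaximal_of_absNorm_eq_prime (by norm_num) h5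
  have hm11 := isMaximal_of_absNorm_eq_prime (by norm_num) h11
  have hN : absNorm (span {((22 : ℤ) : 𝓞 K) + ((1 : ℤ) : 𝓞 K) * b 1}) = 165 := by
    rw [absNorm_span_intCast_add_mul b hb hω]; norm_num
  have h35 : span {(((3 : ℕ) : ℤ) : 𝓞 K), b 1 - (2 : ℤ)} ⊔ span {(((5 : ℕ) : ℤ) : 𝓞 K), b 1 - (3 : ℤ)} = ⊤ :=
    hm3.coprime_of_ne hm5 fun h => by have := congrArg absNorm h; rw [h3, h5] at this; norm_num at this
  have h311 : span {(((3 : ℕ) : ℤ) : 𝓞 K), b 1 - (2 : ℤ)} ⊔ span {(((11 : ℕ) : ℤ) : 𝓞 K), b 1 - (0 : ℤ)} = ⊤ :=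
    hm3.coprime_of_ne hm11 fun h => by have := congrArg absNorm h; rw [h3, h11] at this; norm_num at this
  have h511 : span {(((5 : ℕ) : ℤ) : 𝓞 K), b 1 - (3 : ℤ)} ⊔ span {(((11 : ℕ) : ℤ) : 𝓞 K), b 1 - (0 : ℤ)} = ⊤ :=
    hm5.coprime_of_ne hm11 fun h => by have := congrArg absNorm h; rw [h5, h11] at this; norm_num at this
  have hcop : span {(((3 : ℕ) : ℤ) : 𝓞 K), b 1 - (2 : ℤ)} * span {(((5 : ℕ) : ℤ) : 𝓞 K), b 1 - (3 : ℤ)} ⊔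
      span {(((11 : ℕ) : ℤ) : 𝓞 K), b 1 - (0 : ℤ)} = ⊤ := by
    rw [Ideal.mul_sup_eq_of_coprime_left h311, h511]
  have hmem35 : ((22 : ℤ) : 𝓞 K) + ((1 : ℤ) : 𝓞 K) * b 1 ∈
      span {(((3 : ℕ) : ℤ) : 𝓞 K), b 1 - (2 : ℤ)} * span {(((5 : ℕ) : ℤ) : 𝓞 K), b 1 - (3 : ℤ)} := by
    rw [Ideal.mul_eq_inf_of_coprime h35]
    exact ⟨Ideal.mem_span_pair.mpr ⟨8, 1, by push_cast; ring⟩, Ideal.mem_span_pair.mpr ⟨5, 1, by push_cast; ring⟩⟩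
  refine mul_eq_span_singleton_of_coprime hcop hmem35 (Ideal.mem_span_pair.mpr ⟨2, 1, by push_cast; ring⟩)
    (by rw [hN, map_mul, h3, h5, h11]) (by rw [hN]; norm_num)

/-- The norm form `x² + xy − 341y²` does not take the values `±3, ±5, ±15` (congruences mod `5`; `3`, `13`; `13`, `7`).
[folklore] -/
private theorem normForm_ne_1365 (x y : ℤ) :
    (x ^ 2 + 1 * x * y - 341 * y ^ 2).natAbs ≠ 3 ∧ (x ^ 2 + 1 * x * y - 341 * y ^ 2).natAbs ≠ 5 ∧
      (x ^ 2 + 1 * x * y - 341 * y ^ 2).natAbs ≠ 15 := by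
  refine ⟨fun h => ?_, fun h => ?_, fun h => ?_⟩
  · have h' : x ^ 2 + 1 * x * y - 341 * y ^ 2 = 3 ∨ x ^ 2 + 1 * x * y - 341 * y ^ 2 = -3 := by omega
    rcases h' with h' | h' <;>
    · have h5 := congrArg (Int.cast : ℤ → ZMod 5) h'
      push_cast at h5
      revert h5
      generalize (x : ZMod 5) = a
      generalize (y : ZMod 5) = c
      revert a c
      decide
  · have h' : x ^ 2 + 1 * x * y - 341 * y ^ 2 = 5 ∨ x ^ 2 + 1 * x * y - 341 * y ^ 2 = -5 := by omega
    rcases h' with h' | h'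
    · have h3 := congrArg (Int.cast : ℤ → ZMod 3) h'
      push_cast at h3
      revert h3
      generalize (x : ZMod 3) = a
      generalize (y : ZMod 3) = c
      revert a c
      decide
    · have h13 := congrArg (Int.cast : ℤ → ZMod 13) h'
      push_cast at h13
      revert h13
      generalize (x : ZMod 13) = a
      generalize (y : ZMod 13) = c
      revert a c
      decide
  · have h' : x ^ 2 + 1 * x * y - 341 * y ^ 2 = 15 ∨ x ^ 2 + 1 * x * y - 341 * y ^ 2 = -15 := by omega
    rcases h' with h' | h'
    · have h13 := congrArg (Int.cast : ℤ → ZMod 13) h'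
      push_cast at h13
      revert h13
      generalize (x : ZMod 13) = a
      generalize (y : ZMod 13) = c
      revert a c
      decide
    · have h7 := congrArg (Int.cast : ℤ → ZMod 7) h'
      push_cast at h7
      revert h7
      generalize (x : ZMod 7) = a
      generalize (y : ZMod 7) = c
      revert a c
      decide

include hb hω in
/-- **`𝔭₃`, `𝔭₅` and `𝔭₃𝔭₅` are not principal** (their norms `3, 5, 15` are not values of `|x² + xy − 341y²|`).
[cite: Marcus1977, Ch. 5, examples after Cor. 2 of Thm. 37] -/
theorem not_isPrincipal_1365 :
    ¬ Submodule.IsPrincipal (span {(((3 : ℕ) : ℤ) : 𝓞 K), b 1 - (2 : ℤ)}) ∧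
      ¬ Submodule.IsPrincipal (span {(((5 : ℕ) : ℤ) : 𝓞 K), b 1 - (3 : ℤ)}) ∧
      ¬ Submodule.IsPrincipal
        (span {(((3 : ℕ) : ℤ) : 𝓞 K), b 1 - (2 : ℤ)} * span {(((5 : ℕ) : ℤ) : 𝓞 K), b 1 - (3 : ℤ)}) := by
  obtain ⟨h3, h5, -, -, -⟩ := absNorm_primes_1365 b hb hω
  exact ⟨not_isPrincipal_of_normForm_ne b hb hω h3 fun x y => (normForm_ne_1365 x y).1,
    not_isPrincipal_of_normForm_ne b hb hω h5 fun x y => (normForm_ne_1365 x y).2.1,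
    not_isPrincipal_of_normForm_ne b hb hω (by rw [map_mul, h3, h5]) fun x y => (normForm_ne_1365 x y).2.2⟩

end D1365

/-! ### The class number -/

/-- A rational prime below a maximal ideal `Q` of `𝓞 K` with `N(Q) ≠ 0`: some prime `p ≤ N(Q)` has `p ∈ Q`
(the characteristic of the finite field `𝓞 K/Q`; `N(Q) ∈ {p, p²}`). [cite: Marcus1977, Ch. 3 Thm. 25] -/
theorem exists_prime_mem_of_isMaximal {Q : Ideal (𝓞 K)} (hQ : Q.IsMaximal) (hQ0 : absNorm Q ≠ 0) :
    ∃ p : ℕ, p.Prime ∧ p ≤ absNorm Q ∧ (p : 𝓞 K) ∈ Q := by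
  haveI : Finite (𝓞 K ⧸ Q) := by
    refine Nat.finite_of_card_ne_zero ?_
    rwa [← Submodule.cardQuot_apply, ← Ideal.absNorm_apply]
  letI := Ideal.Quotient.field Q
  obtain ⟨p, hchar⟩ := CharP.exists (𝓞 K ⧸ Q)
  have hp : p.Prime := CharP.char_is_prime (𝓞 K ⧸ Q) p
  have hpQ : (p : 𝓞 K) ∈ Q := by
    rw [← Ideal.Quotient.eq_zero_iff_mem, map_natCast]
    exact CharP.cast_eq_zero _ p
  refine ⟨p, hp, ?_, hpQ⟩
  have hle : span {(p : 𝓞 K)} ≤ Q := (span_singleton_le_iff_mem _).mpr hpQ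
  have hdvd : absNorm Q ∣ absNorm (span {(p : 𝓞 K)}) := absNorm_dvd_absNorm_of_le hle
  rw [Ideal.absNorm_span_natCast] at hdvd
  obtain ⟨i, -, hieq⟩ := (Nat.dvd_prime_pow hp).mp hdvd
  have hi0 : i ≠ 0 := by
    rintro rfl
    rw [pow_zero] at hieq
    exact hQ.ne_top (absNorm_eq_one_iff.mp hieq)
  rw [hieq]
  exact Nat.le_self_pow hi0 p

/-- Classes of non-zero ideals multiply. [folklore] -/
private theorem mk0_mul {I J : Ideal (𝓞 K)} (hI : I ∈ (Ideal (𝓞 K))⁰) (hJ : J ∈ (Ideal (𝓞 K))⁰) :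
    ClassGroup.mk0 ⟨I * J, mul_mem hI hJ⟩ = ClassGroup.mk0 ⟨I, hI⟩ * ClassGroup.mk0 ⟨J, hJ⟩ := by
  rw [← map_mul]; rfl

/-- Equal ideals have equal classes. [folklore] -/
private theorem mk0_congr {I J : Ideal (𝓞 K)} (hI : I ∈ (Ideal (𝓞 K))⁰) (hJ : J ∈ (Ideal (𝓞 K))⁰) (h : I = J) :
    ClassGroup.mk0 ⟨I, hI⟩ = ClassGroup.mk0 ⟨J, hJ⟩ := by
  subst h; rfl

/-- A principal ideal has trivial class. [folklore] -/
private theorem mk0_eq_one_of_eq_span {I : Ideal (𝓞 K)} (hI : I ∈ (Ideal (𝓞 K))⁰) (α : 𝓞 K)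
    (h : I = span {α}) : ClassGroup.mk0 ⟨I, hI⟩ = 1 :=
  (ClassGroup.mk0_eq_one_iff hI).mpr ⟨⟨α, by rw [h, submodule_span_eq]⟩⟩

/-- An ideal of non-zero norm is a non-zero-divisor. [folklore] -/
private theorem mem_nonZeroDivisors_of_absNorm_ne_zero {I : Ideal (𝓞 K)} (h : absNorm I ≠ 0) :
    I ∈ (Ideal (𝓞 K))⁰ :=
  mem_nonZeroDivisors_of_ne_zero (by rintro rfl; exact h absNorm_bot)

section ClassGroup1365

variable (b : Basis (Fin 2) ℤ (𝓞 K)) (hb : b 0 = 1)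
  (hω : b 1 * b 1 = ((341 : ℤ) : 𝓞 K) + ((1 : ℤ) : 𝓞 K) * b 1)
  (h3m : span {(((3 : ℕ) : ℤ) : 𝓞 K), b 1 - (2 : ℤ)} ∈ (Ideal (𝓞 K))⁰)
  (h5m : span {(((5 : ℕ) : ℤ) : 𝓞 K), b 1 - (3 : ℤ)} ∈ (Ideal (𝓞 K))⁰)

include hω in
/-- `[𝔭₃]² = 1` and `[𝔭₅]² = 1` (ramified). [cite: Marcus1977, Ch. 5, examples after Cor. 2 of Thm. 37] -/
theorem sq_classes_1365 :
    ClassGroup.mk0 ⟨_, h3m⟩ * ClassGroup.mk0 ⟨_, h3m⟩ = 1 ∧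
      ClassGroup.mk0 ⟨_, h5m⟩ * ClassGroup.mk0 ⟨_, h5m⟩ = 1 := by
  constructor
  · rw [← mk0_mul]; exact mk0_eq_one_of_eq_span _ _ (p3_sq_1365 b hω)
  · rw [← mk0_mul]; exact mk0_eq_one_of_eq_span _ _ (p5_sq_1365 b hω)

include hb hω in
/-- **Every maximal ideal of norm `≤ 18` has class `1, [𝔭₃], [𝔭₅]` or `[𝔭₃][𝔭₅]`** (`d_K = 1365`): `(2), (17)`
are principal, `𝔭₇ ~ 𝔭₅` by `(17 + ω) = 𝔭₅𝔭₇`, `𝔭₁₃ ~ 𝔭₃` by `(19 + ω) = 𝔭₃𝔭₁₃`, `𝔭₁₁, 𝔭₁₁' ~ 𝔭₃𝔭₅` by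
`(22 + ω) = 𝔭₃𝔭₅𝔭₁₁` and `𝔭₁₁𝔭₁₁' = (11)`. [cite: Marcus1977, Ch. 5, examples after Cor. 2 of Thm. 37] -/
theorem mk0_maximal_cases_1365 {Q : Ideal (𝓞 K)} (hQ : Q.IsMaximal) (hQm : Q ∈ (Ideal (𝓞 K))⁰)
    (hQ18 : absNorm Q ≤ 18) :
    ClassGroup.mk0 ⟨Q, hQm⟩ = 1 ∨ ClassGroup.mk0 ⟨Q, hQm⟩ = ClassGroup.mk0 ⟨_, h3m⟩ ∨
      ClassGroup.mk0 ⟨Q, hQm⟩ = ClassGroup.mk0 ⟨_, h5m⟩ ∨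
      ClassGroup.mk0 ⟨Q, hQm⟩ = ClassGroup.mk0 ⟨_, h3m⟩ * ClassGroup.mk0 ⟨_, h5m⟩ := by
  set c3 := ClassGroup.mk0 ⟨_, h3m⟩ with hc3
  set c5 := ClassGroup.mk0 ⟨_, h5m⟩ with hc5
  obtain ⟨hsq3, hsq5⟩ := sq_classes_1365 b hω h3m h5m
  have hinv3 : c3⁻¹ = c3 := inv_eq_of_mul_eq_one_right hsq3
  have hinv5 : c5⁻¹ = c5 := inv_eq_of_mul_eq_one_right hsq5
  obtain ⟨hN3, hN5, hN7, hN13, hN11⟩ := absNorm_primes_1365 b hb hω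
  have hN11' : absNorm (span {(((11 : ℕ) : ℤ) : 𝓞 K), b 1 - (1 : ℤ)}) = 11 :=
    absNorm_span_pair_prime b hb hω (C := -31) (by norm_num)
  have h7m := mem_nonZeroDivisors_of_absNorm_ne_zero (K := K) (by rw [hN7]; norm_num)
  have h13m := mem_nonZeroDivisors_of_absNorm_ne_zero (K := K) (by rw [hN13]; norm_num)
  have h11m := mem_nonZeroDivisors_of_absNorm_ne_zero (K := K) (by rw [hN11]; norm_num)
  have h11m' := mem_nonZeroDivisors_of_absNorm_ne_zero (K := K) (by rw [hN11']; norm_num)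
  -- the relations
  have hc7 : ClassGroup.mk0 ⟨_, h7m⟩ = c5 := by
    have h : c5 * ClassGroup.mk0 ⟨_, h7m⟩ = 1 := by
      rw [hc5, ← mk0_mul]; exact mk0_eq_one_of_eq_span _ _ (p5_mul_p7_1365 b hb hω)
    rw [← mul_eq_one_iff_inv_eq.mp h, hinv5]
  have hc13 : ClassGroup.mk0 ⟨_, h13m⟩ = c3 := by
    have h : c3 * ClassGroup.mk0 ⟨_, h13m⟩ = 1 := by
      rw [hc3, ← mk0_mul]; exact mk0_eq_one_of_eq_span _ _ (p3_mul_p13_1365 b hb hω)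
    rw [← mul_eq_one_iff_inv_eq.mp h, hinv3]
  have hc11 : ClassGroup.mk0 ⟨_, h11m⟩ = c3 * c5 := by
    have h : c3 * c5 * ClassGroup.mk0 ⟨_, h11m⟩ = 1 := by
      rw [hc3, hc5, ← mk0_mul, ← mk0_mul]; exact mk0_eq_one_of_eq_span _ _ (p3_mul_p5_mul_p11_1365 b hb hω)
    rw [← mul_eq_one_iff_inv_eq.mp h, mul_inv, hinv3, hinv5]
  have hc11' : ClassGroup.mk0 ⟨_, h11m'⟩ = c3 * c5 := by
    have h : ClassGroup.mk0 ⟨_, h11m⟩ * ClassGroup.mk0 ⟨_, h11m'⟩ = 1 := by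
      rw [← mk0_mul]; exact mk0_eq_one_of_eq_span _ _ (p11_mul_conj_1365 b hω)
    rw [← mul_eq_one_iff_inv_eq.mp h, hc11, mul_inv, hinv3, hinv5]
  -- the prime below `Q`
  have hQ0 : absNorm Q ≠ 0 := absNorm_ne_zero_of_nonZeroDivisors ⟨Q, hQm⟩
  obtain ⟨p, hp, hple, hpQ⟩ := exists_prime_mem_of_isMaximal hQ hQ0
  rcases maximal_mem_cases_1365 b hb hω hQ hp (hple.trans hQ18) hpQ with h | h | h | h | h | h | h | h
  · exact Or.inl (mk0_eq_one_of_eq_span hQm _ h)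
  · exact Or.inl (mk0_eq_one_of_eq_span hQm _ h)
  · exact Or.inr (Or.inl (mk0_congr hQm h3m h))
  · exact Or.inr (Or.inr (Or.inl (mk0_congr hQm h5m h)))
  · exact Or.inr (Or.inr (Or.inl (by rw [mk0_congr hQm h7m h, hc7])))
  · exact Or.inr (Or.inl (by rw [mk0_congr hQm h13m h, hc13]))
  · exact Or.inr (Or.inr (Or.inr (by rw [mk0_congr hQm h11m h, hc11])))
  · exact Or.inr (Or.inr (Or.inr (by rw [mk0_congr hQm h11m' h, hc11'])))

include hb hω in
/-- **Every non-zero ideal of norm `≤ 18` has class `1, [𝔭₃], [𝔭₅]` or `[𝔭₃][𝔭₅]`** (peel off a maximal ideal and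
induct on the norm). [cite: Marcus1977, Ch. 5, examples after Cor. 2 of Thm. 37] -/
theorem mk0_cases_1365 {I : Ideal (𝓞 K)} (hIm : I ∈ (Ideal (𝓞 K))⁰) (hI18 : absNorm I ≤ 18) :
    ClassGroup.mk0 ⟨I, hIm⟩ = 1 ∨ ClassGroup.mk0 ⟨I, hIm⟩ = ClassGroup.mk0 ⟨_, h3m⟩ ∨
      ClassGroup.mk0 ⟨I, hIm⟩ = ClassGroup.mk0 ⟨_, h5m⟩ ∨
      ClassGroup.mk0 ⟨I, hIm⟩ = ClassGroup.mk0 ⟨_, h3m⟩ * ClassGroup.mk0 ⟨_, h5m⟩ := by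
  set c3 := ClassGroup.mk0 ⟨_, h3m⟩ with hc3
  set c5 := ClassGroup.mk0 ⟨_, h5m⟩ with hc5
  obtain ⟨hsq3, hsq5⟩ := sq_classes_1365 b hω h3m h5m
  -- closure of `{1, c3, c5, c3 c5}` under multiplication by `c3`, `c5`
  have hmul3 : ∀ x : ClassGroup (𝓞 K), (x = 1 ∨ x = c3 ∨ x = c5 ∨ x = c3 * c5) →
      (c3 * x = 1 ∨ c3 * x = c3 ∨ c3 * x = c5 ∨ c3 * x = c3 * c5) := by
    rintro x (rfl | rfl | rfl | rfl)
    · exact Or.inr (Or.inl (mul_one _))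
    · exact Or.inl hsq3
    · exact Or.inr (Or.inr (Or.inr rfl))
    · exact Or.inr (Or.inr (Or.inl (by rw [← mul_assoc, hsq3, one_mul])))
  have hmul5 : ∀ x : ClassGroup (𝓞 K), (x = 1 ∨ x = c3 ∨ x = c5 ∨ x = c3 * c5) →
      (c5 * x = 1 ∨ c5 * x = c3 ∨ c5 * x = c5 ∨ c5 * x = c3 * c5) := by
    rintro x (rfl | rfl | rfl | rfl)
    · exact Or.inr (Or.inr (Or.inl (mul_one _)))
    · exact Or.inr (Or.inr (Or.inr (mul_comm _ _)))
    · exact Or.inl hsq5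
    · exact Or.inr (Or.inl (by rw [mul_comm c3 c5, ← mul_assoc, hsq5, one_mul]))
  -- induction on the norm
  suffices h : ∀ n : ℕ, ∀ (I : Ideal (𝓞 K)) (hIm : I ∈ (Ideal (𝓞 K))⁰), absNorm I = n → n ≤ 18 →
      (ClassGroup.mk0 ⟨I, hIm⟩ = 1 ∨ ClassGroup.mk0 ⟨I, hIm⟩ = c3 ∨ ClassGroup.mk0 ⟨I, hIm⟩ = c5 ∨
        ClassGroup.mk0 ⟨I, hIm⟩ = c3 * c5) from h _ I hIm rfl hI18
  intro n
  induction n using Nat.strong_induction_on with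
  | _ n ih =>
    intro I hIm hIn hn18
    by_cases hItop : I = ⊤
    · exact Or.inl (mk0_eq_one_of_eq_span hIm 1 (by rw [hItop, Ideal.span_singleton_one]))
    obtain ⟨Q, hQ, hIQ⟩ := Ideal.exists_le_maximal I hItop
    obtain ⟨J, hJ⟩ := Ideal.dvd_iff_le.mpr hIQ
    have hI0 : I ≠ ⊥ := mem_nonZeroDivisors_iff_ne_zero.mp hIm
    have hQm : Q ∈ (Ideal (𝓞 K))⁰ := mem_nonZeroDivisors_of_ne_zero (by
      rintro rfl; exact hI0 (by simpa using hJ))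
    have hJm : J ∈ (Ideal (𝓞 K))⁰ := mem_nonZeroDivisors_of_ne_zero (by
      rintro rfl; exact hI0 (by simpa using hJ))
    have hNQ1 : absNorm Q ≠ 1 := fun h => hQ.ne_top (absNorm_eq_one_iff.mp h)
    have hNQ0 : absNorm Q ≠ 0 := absNorm_ne_zero_of_nonZeroDivisors ⟨Q, hQm⟩
    have hNJ0 : absNorm J ≠ 0 := absNorm_ne_zero_of_nonZeroDivisors ⟨J, hJm⟩
    have hmulN : absNorm Q * absNorm J = n := by rw [← map_mul, ← hJ, hIn]
    have hJlt : absNorm J < n := by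
      have h2 : 2 ≤ absNorm Q := by omega
      nlinarith [Nat.pos_of_ne_zero hNJ0]
    have hQle : absNorm Q ≤ 18 := by nlinarith [Nat.pos_of_ne_zero hNJ0]
    rw [mk0_congr hIm (mul_mem hQm hJm) hJ, mk0_mul hQm hJm]
    have hQS := mk0_maximal_cases_1365 b hb hω h3m h5m hQ hQm hQle
    have hJS := ih (absNorm J) hJlt J hJm rfl (by omega)
    rcases hQS with h | h | h | h
    · rw [h, one_mul]; exact hJS
    · rw [h]; exact hmul3 _ hJS
    · rw [h]; exact hmul5 _ hJS
    · rw [h, mul_assoc]; exact hmul3 _ (hmul5 _ hJS)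

include hb hω in
/-- **`[𝔭₃] ≠ 1`, `[𝔭₅] ≠ 1`, `[𝔭₃][𝔭₅] ≠ 1`** (non-principality). [cite: Marcus1977, Ch. 5, examples after Cor. 2 of Thm. 37] -/
theorem classes_ne_one_1365 :
    ClassGroup.mk0 ⟨_, h3m⟩ ≠ 1 ∧ ClassGroup.mk0 ⟨_, h5m⟩ ≠ 1 ∧
      ClassGroup.mk0 ⟨_, h3m⟩ * ClassGroup.mk0 ⟨_, h5m⟩ ≠ 1 := by
  obtain ⟨hn3, hn5, hn35⟩ := not_isPrincipal_1365 b hb hω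
  refine ⟨fun h => hn3 ((ClassGroup.mk0_eq_one_iff h3m).mp h), fun h => hn5 ((ClassGroup.mk0_eq_one_iff h5m).mp h),
    fun h => hn35 ((ClassGroup.mk0_eq_one_iff (mul_mem h3m h5m)).mp ?_)⟩
  rw [mk0_mul h3m h5m]
  exact h

end ClassGroup1365

/-- **`h(ℚ(√1365)) = 4`**: for a quadratic field `K` with `d_K = 1365 = 3·5·7·13`, `NumberField.classNumber K = 4`,
the classes being `1, [𝔭₃], [𝔭₅], [𝔭₃𝔭₅]` (Minkowski bound `< 19`; `2, 17` inert; `3, 5, 7, 13` ramified; `11`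
split with `𝔭₁₁ ~ 𝔭₃𝔭₅`; `𝔭₇ ~ 𝔭₅`, `𝔭₁₃ ~ 𝔭₃`; `𝔭₃, 𝔭₅, 𝔭₃𝔭₅` non-principal).
[cite: Cohen1993, Appendix B Table B.2] -/
theorem classNumber_eq_four_of_discr_eq_1365 (h2 : finrank ℚ K = 2) (hd : NumberField.discr K = 1365) :
    NumberField.classNumber K = 4 := by
  classical
  obtain ⟨b, hb, hω⟩ := exists_basis_sq_eq_add_of_emod_four_eq_one h2 (by rw [hd]; rfl)
  rw [hd, show ((1365 : ℤ) - 1) / 4 = 341 by norm_num] at hω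
  obtain ⟨hN3, hN5, -, -, -⟩ := absNorm_primes_1365 b hb hω
  have h3m := mem_nonZeroDivisors_of_absNorm_ne_zero (K := K) (by rw [hN3]; norm_num)
  have h5m := mem_nonZeroDivisors_of_absNorm_ne_zero (K := K) (by rw [hN5]; norm_num)
  obtain ⟨hsq3, hsq5⟩ := sq_classes_1365 b hω h3m h5m
  obtain ⟨hc3ne, hc5ne, hc35ne⟩ := classes_ne_one_1365 b hb hω h3m h5m
  have hcases := fun (I : (Ideal (𝓞 K))⁰) (h18 : absNorm (I : Ideal (𝓞 K)) ≤ 18) =>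
    mk0_cases_1365 b hb hω h3m h5m I.2 h18
  set c3 : ClassGroup (𝓞 K) := ClassGroup.mk0 ⟨_, h3m⟩ with hc3
  set c5 : ClassGroup (𝓞 K) := ClassGroup.mk0 ⟨_, h5m⟩ with hc5
  -- Minkowski: every class is the class of an ideal of norm ≤ 18
  have huniv : (Finset.univ : Finset (ClassGroup (𝓞 K))) = {1, c3, c5, c3 * c5} := by
    refine (Finset.eq_univ_of_forall fun c => ?_).symm
    obtain ⟨I, hI, hIle⟩ := NumberField.exists_ideal_in_class_of_norm_le c
    obtain ⟨-, hc0⟩ := nrRealPlaces_eq_two_and_nrComplexPlaces_eq_zero h2 (by rw [hd]; norm_num)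
    rw [hc0, h2, hd] at hIle
    have habs : |((1365 : ℤ) : ℝ)| = 1365 := by norm_num
    rw [habs] at hIle
    have hsqrt : Real.sqrt 1365 < 38 := by
      rw [Real.sqrt_lt' (by norm_num)]; norm_num
    have hlt : (absNorm (I : Ideal (𝓞 K)) : ℝ) < 19 := by
      norm_num [Nat.factorial] at hIle
      linarith
    have h19 : absNorm (I : Ideal (𝓞 K)) < 19 := by exact_mod_cast hlt
    rw [← hI]
    have hmem := hcases I (Nat.lt_succ_iff.mp h19)
    simp only [Finset.mem_insert, Finset.mem_singleton]
    exact hmem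
  -- the four classes are distinct
  have h35 : c3 ≠ c5 := fun h => hc35ne (by rw [h, hsq5])
  have h3_35 : c3 ≠ c3 * c5 := fun h => hc5ne (by
    have h' := congrArg (fun x => c3 * x) h
    simp only [← mul_assoc, hsq3, one_mul] at h'
    exact h'.symm)
  have h5_35 : c5 ≠ c3 * c5 := fun h => hc3ne (by
    have h' := congrArg (fun x => x * c5) h
    simp only [mul_assoc, hsq5, mul_one] at h'
    exact h'.symm)
  rw [NumberField.classNumber, ← Finset.card_univ, huniv,
    Finset.card_insert_of_notMem (by
      simp only [Finset.mem_insert, Finset.mem_singleton, not_or]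
      exact ⟨Ne.symm hc3ne, Ne.symm hc5ne, Ne.symm hc35ne⟩),
    Finset.card_insert_of_notMem (by
      simp only [Finset.mem_insert, Finset.mem_singleton, not_or]
      exact ⟨h35, h3_35⟩),
    Finset.card_insert_of_notMem (by simp only [Finset.mem_singleton]; exact h5_35),
    Finset.card_singleton]

/-- `d_K = 1365`: `h_K · R_K = 4 log ((37 + √1365)/2)`. [cite: Cohen1993, Appendix B Table B.2] -/
theorem classNumber_mul_regulator_of_discr_eq_1365 (h2 : finrank ℚ K = 2) (hd : NumberField.discr K = 1365) :
    (NumberField.classNumber K : ℝ) * Units.regulator K = 4 * Real.log ((37 + 1 * Real.sqrt 1365) / 2) := by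
  rw [classNumber_eq_four_of_discr_eq_1365 h2 hd, regulator_of_discr_eq_1365 h2 hd]
  norm_num

end Literature.NumberTheory.QuadraticFields.Quadratic

end
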